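import Literature.AlgebraicGeometry.HilbertScheme.TransferOperatorCommutators
import HarnessLib

/-!
# Transfer operators for surfaces with odd cohomology: the super-versions of Oberdieck's Lemma 3.4 (`k = 1`)
and Cor. 3.5, proved from the Heisenberg axioms

Layer `Literature/AlgebraicGeometry/HilbertScheme`; sequel of `TransferOperatorCommutators` (which proves the two
statements for EVEN coefficient algebras, `H^odd(S) = 0`, Oberdieck's printed generality read in cohomology).
G. Oberdieck, Comment. Math. Helv. 96 (2021) §3.2 Lemma 3.4 / Cor. 3.5 are stated in Chow, where every class is
even; for a surface with `H^odd(S(ℂ); ℂ) ≠ 0` (an abelian surface: `b₁ = 4`) Nakajima's operators `𝔮ₘ(γ)`, `γ` odd,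
are odd and satisfy the SUPER-relations of Li–Qin–Wang (Math. Ann. 324 (2002), (2.7) and Thm. 2.16 (i)):
`𝔮ₘ(a)𝔮ₗ(b) − (−1)^{|a||b|}𝔮ₗ(b)𝔮ₘ(a) = m δ_{m+l,0} ⟨a, b⟩`.  This file PROVES that Oberdieck's two identities hold
VERBATIM in the super setting — the transfer operator `T(φ) = −Σ_{n≥1} n^{t−1} Σᵢ 𝔮ₙ(φεᵢ)𝔮₋ₙ(eᵢ)` of a graded
endomorphism `φ` of even degree is an even operator and

* `IsHeisenbergRepresentation.transferOp_commute_graded` / `NakajimaOperators.transferOp_commute_super`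
  (**Lemma 3.4, `k = 1`, all classes**): `T(φ)𝔮ₘ(v) − 𝔮ₘ(v)T(φ) = mᵗ 𝔮ₘ(φ v)` for `m > 0` and EVERY `v`;
* `IsHeisenbergRepresentation.transferOp_lie_graded` / `NakajimaOperators.transferOp_lie_super` (**Cor. 3.5**):
  `[T(φ), T(ψ)] = T([φ, ψ])`;
* `ChernCharacterOperators.cupOperator_zero_eq_transferOp_super`: Lehn's `𝔊₀(α) = T(L_α)` for every surface —

under the hypotheses that make Oberdieck's three-line computation go through with signs (his argument, our
bookkeeping; the statements are not printed in this generality): the pairing is GRADED-SYMMETRIC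
(`⟨a, b⟩ = (−1)^{|a||b|}⟨b, a⟩` — for the Poincaré pairing this is graded commutativity of the cup product,
`poincarePairing_graded_symm`), the Casimir tensor `C = Σᵢ eᵢ ⊗ εᵢ` is EVEN (`|eᵢ| + |εᵢ|` even — the Künneth
components of the diagonal have `|eᵢ| + |εᵢ| = 4`; `evenTensorSpan`), and `φ` preserves parity classes
(`paritySpan`; automatic for a graded endomorphism of even degree, `IsOfDegree.mem_paritySpan`).  The heart is
`transfer_core_apply`: for homogeneous `e, ε, γ` the two signs `(−1)^{|γ||φε|}` and `(−1)^{|γ||e|}` picked up when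
`𝔮ₘ(γ)` moves past `𝔮ₙ(φε)` and `𝔮₋ₙ(e)` multiply to `(−1)^{|γ|(|e|+|ε|)} = 1`, and `⟨γ, e⟩ = (−1)^{|γ||e|}⟨e, γ⟩`
absorbs the remaining sign.  These are the operator identities behind the Lefschetz dual `T(Λ_A)` of `D_α` on
`A^[n]` for an abelian surface `A` (lane (V) of the `hodge-kum4` ladder; Summits-side support statements
`Summit.Ventures.HodgeKum4.TransferBracketSuper` etc. are hereby theorems under the even-Casimir hypothesis).

## Contents

* `paritySpan K A p` (classes of parity `p`), `evenTensorSpan K A` (even tensors) — definitions + API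
  (`lof_mem_paritySpan`, `paritySpan_eq_of_even`, `map_mem_paritySpan`, `tmul_mem_evenTensorSpan`,
  `neg_one_pow_mul_eq_of_even_add`);
* `IsHeisenbergRepresentation.bracket_apply`, `bracket_apply_of_mem_paritySpan` (the super-relations at vectors),
  `transfer_core_apply`, `transferTerm_commute_apply_graded_lof`, `transferOp_commute_graded`, `transferOp_lie_graded`;
* geometric: `poincarePairing_graded_symm`, `IsOfDegree.mem_paritySpan`, `NakajimaOperators.transferOp_commute_super`,
  `NakajimaOperators.transferOp_lie_super`, `ChernCharacterOperators.cupOperator_zero_eq_transferOp_super`.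

All proved (standard axioms); no named facts.  Not here: that EVERY Casimir element of the Poincaré pairing is even
(true by perfectness — Poincaré duality — and uniqueness of the Casimir element; not needed downstream, where `C`
is the Künneth class of the diagonal); `T(h_S)|ₙ = h_{S^[n]}` and the `𝔰𝔩₂`-triple on `H*(S^[n])` (sequel).
-/

noncomputable section

open DirectSum TensorProduct

namespace Literature.AlgebraicGeometry.HilbertScheme

universe u v w

variable {K : Type u} [Field K]
variable {A : ℕ → Type v} [∀ i, AddCommGroup (A i)] [∀ i, Module K (A i)]
variable {Φ : ℕ → ℕ → Type w} [∀ n i, AddCommGroup (Φ n i)] [∀ n i, Module K (Φ n i)]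

/-! ### Parity classes of the coefficient space and even tensors -/

variable (K A) in
/-- **The classes of parity `p`**: the span of the homogeneous elements `b ∈ A j` with `j ≡ p (mod 2)` — for
`A j = Hʲ(S)`: `H^{ev}(S)` (`p` even) and `H^{odd}(S)` (`p` odd), the `ℤ/2`-grading by which the signs of the
Heisenberg superalgebra (2.7) are governed. [cite: LiQinWang2002, Def. 2.5 and (2.7) p. 4] -/
def paritySpan (p : ℕ) : Submodule K (⨁ i, A i) :=
  Submodule.span K {v | ∃ (j : ℕ) (b : A j), Even (j + p) ∧ v = lof K ℕ A j b}

variable (K A) in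
/-- **Even tensors**: the span of the pure tensors `e ⊗ ε` of homogeneous elements of total even degree
`|e| + |ε|` — the parity of the Künneth components of the diagonal class of a surface (`|e| + |ε| = 4`), i.e. of the
canonical Casimir element of the Poincaré pairing. [cite: LiQinWang2002, Def. 2.9 (iii) p. 5]
[cite: Lehn1999, §3.1 p. 8] -/
def evenTensorSpan : Submodule K ((⨁ i, A i) ⊗[K] (⨁ i, A i)) :=
  Submodule.span K {c | ∃ (i j : ℕ) (e : A i) (ε : A j), Even (i + j) ∧ c = lof K ℕ A i e ⊗ₜ[K] lof K ℕ A j ε}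

/-- A homogeneous element of degree `j ≡ p` has parity `p`. [cite: LiQinWang2002, (2.7) p. 4] -/
theorem lof_mem_paritySpan {j p : ℕ} (hjp : Even (j + p)) (b : A j) : lof K ℕ A j b ∈ paritySpan K A p :=
  Submodule.subset_span ⟨j, b, hjp, rfl⟩

/-- A pure tensor of homogeneous elements of even total degree is an even tensor.
[cite: LiQinWang2002, Def. 2.9 (iii) p. 5] -/
theorem tmul_mem_evenTensorSpan {i j : ℕ} (hij : Even (i + j)) (e : A i) (ε : A j) :
    lof K ℕ A i e ⊗ₜ[K] lof K ℕ A j ε ∈ evenTensorSpan K A :=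
  Submodule.subset_span ⟨i, j, e, ε, hij, rfl⟩

/-- Parity classes depend only on the parity. [cite: LiQinWang2002, (2.7) p. 4] -/
theorem paritySpan_eq_of_even {p p' : ℕ} (hpp : Even (p + p')) : paritySpan K A p = paritySpan K A p' := by
  have key : ∀ j : ℕ, Even (j + p) ↔ Even (j + p') := fun j ↦ by
    rw [Nat.even_add, Nat.even_add, (Nat.even_add.mp hpp)]
  unfold paritySpan
  congr 1
  ext v
  simp only [Set.mem_setOf_eq, key]

/-- An endomorphism mapping each homogeneous element to its own parity class preserves every parity class.
[cite: LiQinWang2002, (2.7) p. 4] -/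
theorem map_mem_paritySpan {φ : (⨁ i, A i) →ₗ[K] (⨁ i, A i)}
    (hφ : ∀ (j : ℕ) (ε : A j), φ (lof K ℕ A j ε) ∈ paritySpan K A j) {p : ℕ} {w : ⨁ i, A i}
    (hw : w ∈ paritySpan K A p) : φ w ∈ paritySpan K A p := by
  induction hw using Submodule.span_induction with
  | mem w hw =>
    obtain ⟨j, b, hjp, rfl⟩ := hw
    rw [← paritySpan_eq_of_even hjp]
    exact hφ j b
  | zero => rw [map_zero]; exact Submodule.zero_mem _
  | add w w' _ _ hw hw' => rw [map_add]; exact Submodule.add_mem _ hw hw'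
  | smul c w _ hw => rw [map_smul]; exact Submodule.smul_mem _ c hw

/-- Sign bookkeeping: `(−1)^{ij} = (−1)^{ip}` for `j ≡ p (mod 2)`. [cite: LiQinWang2002, (2.7) p. 4] -/
theorem neg_one_pow_mul_eq_of_even_add (i : ℕ) {j p : ℕ} (hjp : Even (j + p)) :
    ((-1 : K) ^ (i * j)) = (-1) ^ (i * p) := by
  have hiff : Even (i * j) ↔ Even (i * p) := by
    rw [Nat.even_mul, Nat.even_mul, (Nat.even_add.mp hjp)]
  rcases Nat.even_or_odd (i * j) with hij | hij
  · rw [hij.neg_one_pow, (hiff.mp hij).neg_one_pow]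
  · have hip : Odd (i * p) := Nat.not_even_iff_odd.mp fun h ↦ (Nat.not_even_iff_odd.mpr hij) (hiff.mpr h)
    rw [hij.neg_one_pow, hip.neg_one_pow]

namespace IsHeisenbergRepresentation

variable {B : (⨁ i, A i) →ₗ[K] (⨁ i, A i) →ₗ[K] K} {q : ℤ → (⨁ i, A i) →ₗ[K] Module.End K (Fock Φ)}
  {vac : Fock Φ}

/-! ### The super-relations at the level of vectors -/

/-- The Heisenberg super-relation for homogeneous coefficients, applied to a vector:
`𝔮ₘ(a)𝔮ₗ(b)x − (−1)^{|a||b|} 𝔮ₗ(b)𝔮ₘ(a)x = δ_{m+l,0} m⟨a,b⟩ x`. [cite: LiQinWang2002, Thm. 2.16 (i) and (2.7) (pp. 4–5)] -/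
theorem bracket_apply (h : IsHeisenbergRepresentation B q vac) (m l : ℤ) (i j : ℕ) (a : A i) (b : A j)
    (x : Fock Φ) :
    q m (lof K ℕ A i a) (q l (lof K ℕ A j b) x) - ((-1 : K) ^ (i * j)) • q l (lof K ℕ A j b) (q m (lof K ℕ A i a) x) =
      if m + l = 0 then ((m : K) * B (lof K ℕ A i a) (lof K ℕ A j b)) • x else 0 := by
  have hb := LinearMap.congr_fun (h.bracket m l i j a b) x
  simp only [LinearMap.sub_apply, Module.End.mul_apply, LinearMap.smul_apply] at hb
  rw [hb]
  split_ifs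
  · rw [LinearMap.smul_apply, Module.End.one_apply]
  · rw [LinearMap.zero_apply]

/-- The super-relation of a homogeneous `𝔮ₘ(a)`, `a ∈ A i`, with `𝔮ₗ(w)` for `w` of pure parity `p` (a sum of
homogeneous classes of degrees `≡ p`): the sign is `(−1)^{ip}`. [cite: LiQinWang2002, Thm. 2.16 (i) and (2.7) (pp. 4–5)] -/
theorem bracket_apply_of_mem_paritySpan (h : IsHeisenbergRepresentation B q vac) {i : ℕ} (a : A i) {p : ℕ}
    {w : ⨁ i, A i} (hw : w ∈ paritySpan K A p) (m l : ℤ) (x : Fock Φ) :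
    q m (lof K ℕ A i a) (q l w x) - ((-1 : K) ^ (i * p)) • q l w (q m (lof K ℕ A i a) x) =
      if m + l = 0 then ((m : K) * B (lof K ℕ A i a) w) • x else 0 := by
  induction hw using Submodule.span_induction with
  | mem w hw =>
    obtain ⟨j, b, hjp, rfl⟩ := hw
    rw [← neg_one_pow_mul_eq_of_even_add i hjp]
    exact h.bracket_apply m l i j a b x
  | zero =>
    simp only [map_zero, LinearMap.zero_apply, smul_zero, sub_self, mul_zero, zero_smul]
    split_ifs <;> rfl
  | add w w' _ _ hw hw' =>
    simp only [map_add, LinearMap.add_apply, smul_add]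
    rw [show ∀ p₁ p₂ r₁ r₂ : Fock Φ, p₁ + p₂ - (r₁ + r₂) = (p₁ - r₁) + (p₂ - r₂) by intros; abel, hw, hw']
    split_ifs
    · rw [mul_add, add_smul]
    · rw [add_zero]
  | smul c w _ hw =>
    simp only [map_smul, LinearMap.smul_apply, smul_eq_mul]
    rw [smul_comm ((-1 : K) ^ (i * p)) c, ← smul_sub, hw]
    split_ifs
    · rw [smul_smul]
      congr 1
      ring
    · rw [smul_zero]

/-! ### The transfer-term commutator with signs (Oberdieck's computation in the super setting) -/

/-- **Core computation.**  For homogeneous `e ∈ A i`, `ε ∈ A j` with `i + j` even, a homogeneous `γ ∈ A k`, an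
endomorphism `φ` preserving parity classes, and `n, m > 0`:
`𝔮ₙ(φε)𝔮₋ₙ(e)𝔮ₘ(γ)x − 𝔮ₘ(γ)𝔮ₙ(φε)𝔮₋ₙ(e)x = −δ_{n,m} m⟨e,γ⟩ 𝔮ₙ(φε)x` — the two signs `(−1)^{k|φε|}` and
`(−1)^{k|e|}` of (2.7) cancel because `|e| + |ε|` is even, and `⟨γ, e⟩ = (−1)^{k|e|}⟨e, γ⟩`.
[cite: Oberdieck2021, §3.2 Lemma 3.4 (proof) p. 7] [cite: LiQinWang2002, (2.7) p. 4] -/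
theorem transfer_core_apply (h : IsHeisenbergRepresentation B q vac)
    (hB : ∀ (i j : ℕ) (a : A i) (b : A j),
      B (lof K ℕ A i a) (lof K ℕ A j b) = (-1 : K) ^ (i * j) * B (lof K ℕ A j b) (lof K ℕ A i a))
    {φ : (⨁ i, A i) →ₗ[K] (⨁ i, A i)} (hφ : ∀ (j : ℕ) (ε : A j), φ (lof K ℕ A j ε) ∈ paritySpan K A j)
    {i j k : ℕ} (hij : Even (i + j)) (e : A i) (ε : A j) (γ : A k) {n m : ℤ} (hn : 0 < n) (hm : 0 < m)
    (x : Fock Φ) :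
    q n (φ (lof K ℕ A j ε)) (q (-n) (lof K ℕ A i e) (q m (lof K ℕ A k γ) x)) -
        q m (lof K ℕ A k γ) (q n (φ (lof K ℕ A j ε)) (q (-n) (lof K ℕ A i e) x)) =
      if n = m then -(((m : K) * B (lof K ℕ A i e) (lof K ℕ A k γ)) • q n (φ (lof K ℕ A j ε)) x) else 0 := by
  -- the signs
  have hs : ((-1 : K) ^ (k * j)) * (-1) ^ (k * i) = 1 := by
    rw [← pow_add, ← mul_add]
    exact (Even.mul_left (by rwa [add_comm]) k).neg_one_pow
  -- (I') `𝔮ₘ(γ)` super-commutes with `𝔮ₙ(φε)` (`m + n ≠ 0`)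
  have h1 := h.bracket_apply_of_mem_paritySpan γ (hφ j ε) m n (q (-n) (lof K ℕ A i e) x)
  rw [if_neg (by omega), sub_eq_zero] at h1
  -- (II') `𝔮ₘ(γ)𝔮₋ₙ(e) = (−1)^{ki} 𝔮₋ₙ(e)𝔮ₘ(γ) + δ_{m,n} m⟨γ,e⟩`
  have h2 := h.bracket_apply m (-n) k i γ e x
  rw [h1, sub_eq_iff_eq_add'.mp h2, map_add, map_smul, smul_add, smul_smul, hs, one_smul, sub_add_cancel_left]
  by_cases hnm : n = m
  · subst hnm
    rw [if_pos (by omega), if_pos rfl, map_smul, smul_smul, hB k i γ e]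
    congr 2
    linear_combination ((n : K) * B (lof K ℕ A i e) (lof K ℕ A k γ)) * hs
  · rw [if_neg (by omega), if_neg hnm, map_zero, smul_zero, neg_zero]

/-- The transfer-term commutator for an even tensor `C` and a homogeneous `γ`:
`[Σᵢ 𝔮ₙ(φεᵢ)𝔮₋ₙ(eᵢ), 𝔮ₘ(γ)] x = −δ_{n,m} m 𝔮ₘ(φ(Σᵢ⟨eᵢ,γ⟩εᵢ)) x`. [cite: Oberdieck2021, §3.2 Lemma 3.4 (proof) p. 7] -/
theorem transferTerm_commute_apply_graded_lof (h : IsHeisenbergRepresentation B q vac)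
    (hB : ∀ (i j : ℕ) (a : A i) (b : A j),
      B (lof K ℕ A i a) (lof K ℕ A j b) = (-1 : K) ^ (i * j) * B (lof K ℕ A j b) (lof K ℕ A i a))
    {C : (⨁ i, A i) ⊗[K] (⨁ i, A i)} (hCg : C ∈ evenTensorSpan K A)
    {φ : (⨁ i, A i) →ₗ[K] (⨁ i, A i)} (hφ : ∀ (j : ℕ) (ε : A j), φ (lof K ℕ A j ε) ∈ paritySpan K A j)
    {n m : ℤ} (hn : 0 < n) (hm : 0 < m) {k : ℕ} (γ : A k) (x : Fock Φ) :
    transferTerm K q C φ n (q m (lof K ℕ A k γ) x) - q m (lof K ℕ A k γ) (transferTerm K q C φ n x) =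
      if n = m then
        -(((m : K)) • q m (φ (TensorProduct.lift ((LinearMap.lsmul K (⨁ i, A i)).comp (B.flip (lof K ℕ A k γ))) C)) x)
      else 0 := by
  induction hCg using Submodule.span_induction with
  | mem c hc =>
    obtain ⟨i, j, e, ε, hij, rfl⟩ := hc
    rw [transferTerm_tmul, TensorProduct.lift.tmul, Module.End.mul_apply, Module.End.mul_apply,
      h.transfer_core_apply hB hφ hij e ε γ hn hm x]
    by_cases hnm : n = m
    · subst hnm
      rw [if_pos rfl, if_pos rfl, LinearMap.comp_apply, LinearMap.flip_apply, LinearMap.lsmul_apply, map_smul,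
        map_smul, LinearMap.smul_apply, smul_smul]
    · rw [if_neg hnm, if_neg hnm]
  | zero =>
    simp only [transferTerm, map_zero, LinearMap.zero_apply, sub_self, smul_zero, neg_zero]
    split_ifs <;> rfl
  | add y y' _ _ hy hy' =>
    have hsplit : transferTerm K q (y + y') φ n = transferTerm K q y φ n + transferTerm K q y' φ n := by
      simp [transferTerm, map_add]
    rw [hsplit, LinearMap.add_apply, LinearMap.add_apply, map_add,
      show ∀ p q r s : Fock Φ, p + q - (r + s) = (p - r) + (q - s) by intros; abel, hy, hy', map_add]
    split_ifs
    · rw [map_add, map_add, LinearMap.add_apply, smul_add, neg_add]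
    · rw [add_zero]
  | smul c y _ hy =>
    have hsplit : transferTerm K q (c • y) φ n = c • transferTerm K q y φ n := by
      simp [transferTerm, map_smul]
    rw [hsplit, LinearMap.smul_apply, LinearMap.smul_apply, map_smul, ← smul_sub, hy, map_smul]
    split_ifs
    · rw [map_smul, map_smul, LinearMap.smul_apply, smul_neg, smul_comm c]
    · rw [smul_zero]

/-- **Oberdieck's Lemma 3.4 (`k = 1`, `m > 0`), SUPER-VERSION, from the axioms.**  For a Heisenberg representation
of a graded coefficient algebra whose pairing is graded-symmetric (`⟨a, b⟩ = (−1)^{|a||b|}⟨b, a⟩`), an EVEN Casimir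
tensor `C` (`Σᵢ eᵢ ⊗ εᵢ` with `|eᵢ| + |εᵢ|` even and `Σᵢ ⟨eᵢ, v⟩εᵢ = v`), a parity-preserving `φ` and `t ∈ ℤ`:
`T(φ)𝔮ₘ(v) − 𝔮ₘ(v)T(φ) = mᵗ 𝔮ₘ(φv)` for every `m > 0` and EVERY `v` (odd classes allowed; the signs of (2.7) cancel).
Oberdieck states the identity in Chow (even classes); the computation is his.
[cite: Oberdieck2021, §3.2 Lemma 3.4 p. 7] [cite: LiQinWang2002, (2.7) and Thm. 2.16 (i) (pp. 4–5)] -/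
theorem transferOp_commute_graded [CharZero K] (h : IsHeisenbergRepresentation B q vac)
    (hB : ∀ (i j : ℕ) (a : A i) (b : A j),
      B (lof K ℕ A i a) (lof K ℕ A j b) = (-1 : K) ^ (i * j) * B (lof K ℕ A j b) (lof K ℕ A i a))
    {C : (⨁ i, A i) ⊗[K] (⨁ i, A i)} (hCg : C ∈ evenTensorSpan K A) (hC : IsCasimir K B C) (t : ℤ)
    {φ : (⨁ i, A i) →ₗ[K] (⨁ i, A i)} (hφ : ∀ (j : ℕ) (ε : A j), φ (lof K ℕ A j ε) ∈ paritySpan K A j)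
    {m : ℤ} (hm : 0 < m) (v : ⨁ i, A i) :
    transferOp K q C t φ * q m v - q m v * transferOp K q C t φ = ((m : K) ^ t) • q m (φ v) := by
  induction v using DirectSum.induction_on with
  | zero =>
    simp only [map_zero, mul_zero, zero_mul, smul_zero]
    abel
  | add v w hv hw =>
    simp only [map_add, mul_add, add_mul, smul_add]
    rw [← hv, ← hw]
    abel
  | of k γ =>
  rw [← DirectSum.lof_eq_of K]
  obtain ⟨m', rfl⟩ := Int.eq_ofNat_of_zero_le hm.le
  have hm' : 1 ≤ m' := by exact_mod_cast hm
  have hm0 : (m' : K) ≠ 0 := by exact_mod_cast (show m' ≠ 0 by omega)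
  push_cast
  refine DirectSum.linearMap_ext K fun p ↦ LinearMap.ext fun y ↦ ?_
  simp only [LinearMap.coe_comp, Function.comp_apply, LinearMap.sub_apply, Module.End.mul_apply,
    LinearMap.smul_apply]
  rw [show (lof K ℕ (fun n ↦ FockSummand Φ n) p) y = Fock.ofSummand K Φ p y from rfl]
  obtain ⟨z, hz⟩ :=
    h.apply_ofSummand_mem_range (m' : ℤ) (lof K ℕ A k γ) (p := p) (p' := p + m') (by push_cast; ring) y
  rw [← hz, h.transferOp_apply_ofSummand_of_le C t φ le_rfl z,
    h.transferOp_apply_ofSummand_of_le C t φ (Nat.le_add_right p m') y, hz, map_neg, map_sum, sub_neg_eq_add,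
    neg_add_eq_sub, ← Finset.sum_sub_distrib]
  have hterm : ∀ n ∈ Finset.Icc 1 (p + m'),
      q (m' : ℤ) (lof K ℕ A k γ) (((n : K) ^ (t - 1)) • transferTerm K q C φ (n : ℤ) (Fock.ofSummand K Φ p y)) -
          ((n : K) ^ (t - 1)) •
            transferTerm K q C φ (n : ℤ) (q (m' : ℤ) (lof K ℕ A k γ) (Fock.ofSummand K Φ p y)) =
        if n = m' then ((m' : K) ^ t) • q (m' : ℤ) (φ (lof K ℕ A k γ)) (Fock.ofSummand K Φ p y) else 0 := by
    intro n hn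
    have hn1 : (0 : ℤ) < n := by
      simp only [Finset.mem_Icc] at hn
      exact_mod_cast hn.1
    have hc := h.transferTerm_commute_apply_graded_lof hB hCg hφ hn1 hm γ (Fock.ofSummand K Φ p y)
    simp only [hC (lof K ℕ A k γ), Int.cast_natCast, Nat.cast_inj] at hc
    rw [map_smul, ← smul_sub, show ∀ a b : Fock Φ, a - b = -(b - a) from fun a b ↦ (neg_sub b a).symm, hc]
    by_cases hnm : n = m'
    · subst hnm
      rw [if_pos rfl, if_pos rfl, neg_neg, smul_smul, ← zpow_add_one₀ hm0, sub_add_cancel]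
    · rw [if_neg hnm, if_neg hnm, neg_zero, smul_zero]
  rw [Finset.sum_congr rfl hterm, Finset.sum_ite_eq' (Finset.Icc 1 (p + m')) m', if_pos (by simp [hm'])]

/-- **Oberdieck's Cor. 3.5, SUPER-VERSION, from the axioms**: `[T(φ), T(ψ)] = T([φ, ψ])` for parity-preserving
`φ, ψ`, an even Casimir tensor and a graded-symmetric pairing (characteristic zero).
[cite: Oberdieck2021, §3.2 Cor. 3.5 p. 7] [cite: LiQinWang2002, (2.7) p. 4] -/
theorem transferOp_lie_graded [CharZero K] (h : IsHeisenbergRepresentation B q vac)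
    (hB : ∀ (i j : ℕ) (a : A i) (b : A j),
      B (lof K ℕ A i a) (lof K ℕ A j b) = (-1 : K) ^ (i * j) * B (lof K ℕ A j b) (lof K ℕ A i a))
    {C : (⨁ i, A i) ⊗[K] (⨁ i, A i)} (hCg : C ∈ evenTensorSpan K A) (hC : IsCasimir K B C) (t t' : ℤ)
    {φ ψ : (⨁ i, A i) →ₗ[K] (⨁ i, A i)} (hφ : ∀ (j : ℕ) (ε : A j), φ (lof K ℕ A j ε) ∈ paritySpan K A j)
    (hψ : ∀ (j : ℕ) (ε : A j), ψ (lof K ℕ A j ε) ∈ paritySpan K A j) :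
    transferOp K q C t φ * transferOp K q C t' ψ - transferOp K q C t' ψ * transferOp K q C t φ =
      transferOp K q C (t + t') (φ * ψ - ψ * φ) := by
  have hχ : ∀ (j : ℕ) (ε : A j), (φ * ψ - ψ * φ) (lof K ℕ A j ε) ∈ paritySpan K A j := fun j ε ↦ by
    rw [LinearMap.sub_apply, Module.End.mul_apply, Module.End.mul_apply]
    exact Submodule.sub_mem _ (map_mem_paritySpan hφ (hψ j ε)) (map_mem_paritySpan hψ (hφ j ε))
  refine h.ext_of_commute ?_ ?_
  · rw [LinearMap.sub_apply, Module.End.mul_apply, Module.End.mul_apply, transferOp_vac h C t' ψ,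
      transferOp_vac h C t φ, map_zero, map_zero, sub_self, transferOp_vac h C (t + t')]
  · intro m hm v
    have hm0 : (m : K) ≠ 0 := by exact_mod_cast hm.ne'
    have e1 := fun x ↦ LinearMap.congr_fun (h.transferOp_commute_graded hB hCg hC t hφ hm v) x
    have e2 := fun x ↦ LinearMap.congr_fun (h.transferOp_commute_graded hB hCg hC t' hψ hm v) x
    have e3 := fun x ↦ LinearMap.congr_fun (h.transferOp_commute_graded hB hCg hC t hφ hm (ψ v)) x
    have e4 := fun x ↦ LinearMap.congr_fun (h.transferOp_commute_graded hB hCg hC t' hψ hm (φ v)) x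
    have e5 := fun x ↦ LinearMap.congr_fun (h.transferOp_commute_graded hB hCg hC (t + t') hχ hm v) x
    simp only [LinearMap.sub_apply, Module.End.mul_apply, LinearMap.smul_apply] at e1 e2 e3 e4 e5
    refine LinearMap.ext fun x ↦ ?_
    simp only [LinearMap.sub_apply, Module.End.mul_apply, map_sub]
    set Tφ := transferOp K q C t φ
    set Tψ := transferOp K q C t' ψ
    rw [e5 x, sub_eq_iff_eq_add'.mp (e2 x), sub_eq_iff_eq_add'.mp (e1 x), map_add, map_add, map_smul, map_smul,
      sub_eq_iff_eq_add'.mp (e1 (Tψ x)), sub_eq_iff_eq_add'.mp (e2 (Tφ x)), sub_eq_iff_eq_add'.mp (e3 x),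
      sub_eq_iff_eq_add'.mp (e4 x), smul_add, smul_add, smul_smul, smul_smul, ← zpow_add₀ hm0, ← zpow_add₀ hm0,
      add_comm t' t, LinearMap.map_sub₂, smul_sub]
    abel

end IsHeisenbergRepresentation

/-! ### Geometric form: every smooth projective surface (odd cohomology allowed) -/

section Geometric

open Literature.AlgebraicTopology.SingularHomology
open Literature.AlgebraicGeometry.Motives (SchemeOver ComplexPoints IsSmoothProjective)
open Literature.AlgebraicGeometry.Hyperkaehler (totalCohomology ofDegree totalCup totalLefschetz)
open Literature.AlgebraicGeometry.HodgeTheory (complexBetti)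

variable {S : SchemeOver ℂ}

/-- Re-indexing a homogeneous cup product along an equality of degrees (plumbing). [folklore] -/
private theorem ofDegree_cupProduct_eq {Y : Type} [TopologicalSpace Y] {p q n : ℕ} (hpq : p + q = n)
    (x : singularCohomology ℂ ℂ Y p) (y : singularCohomology ℂ ℂ Y q) :
    ofDegree ℂ Y n (cupProduct hpq x y) = ofDegree ℂ Y (p + q) (cupProduct rfl x y) := by
  subst hpq
  rfl

/-- **The Poincaré pairing of a smooth projective variety is graded-symmetric**:
`∫ a ∪ b = (−1)^{|a||b|} ∫ b ∪ a` for homogeneous `a`, `b` (graded commutativity of the cup product, Hatcher Thm. 3.11).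
[cite: LiQinWang2002, §2 p. 4 ("super-symmetric bilinear form")] -/
theorem poincarePairing_graded_symm {d : ℕ} (hX : IsSmoothProjective d S) (i j : ℕ) (a : complexBetti S i)
    (b : complexBetti S j) :
    poincarePairing hX (ofDegree ℂ (ComplexPoints S) i a) (ofDegree ℂ (ComplexPoints S) j b) =
      (-1 : ℂ) ^ (i * j) *
        poincarePairing hX (ofDegree ℂ (ComplexPoints S) j b) (ofDegree ℂ (ComplexPoints S) i a) := by
  rw [poincarePairing_apply, poincarePairing_apply, Hyperkaehler.totalCup_lof, Hyperkaehler.totalCup_lof,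
    cupProduct_gradedComm_holds ℂ (ComplexPoints S) rfl (Nat.add_comm j i) a b, map_smul, map_smul,
    ofDegree_cupProduct_eq (Nat.add_comm j i) b a, smul_eq_mul]

/-- A graded endomorphism of even degree `2t` of `H*(S(ℂ); ℂ)` preserves parity classes.
[cite: Oberdieck2021, §3.2 p. 7] -/
theorem IsOfDegree.mem_paritySpan {Y : Type} [TopologicalSpace Y] {φ : Module.End ℂ (totalCohomology ℂ Y)}
    {t : ℤ} (hφ : IsOfDegree ℂ Y φ (2 * t)) (j : ℕ) (ε : singularCohomology ℂ ℂ Y j) :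
    φ (ofDegree ℂ Y j ε) ∈ paritySpan ℂ (fun k ↦ singularCohomology ℂ ℂ Y k) j := by
  have hmem := hφ j ε
  unfold shiftedPart at hmem
  split_ifs at hmem with hj
  · obtain ⟨y, hy⟩ := hmem
    rw [← hy]
    have hcast : (((j : ℤ) + 2 * t).toNat : ℤ) = j + 2 * t := Int.toNat_of_nonneg hj
    have hev : Even ((((j : ℤ) + 2 * t).toNat : ℤ) + j) := ⟨j + t, by rw [hcast]; ring⟩
    exact lof_mem_paritySpan (A := fun k ↦ singularCohomology ℂ ℂ Y k) (by exact_mod_cast hev) y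
  · rw [Submodule.mem_bot] at hmem
    rw [hmem]
    exact Submodule.zero_mem _

variable {hS : IsSmoothProjective 2 S} {H : HilbertSchemesOfPoints S}

/-- **Oberdieck's Lemma 3.4 (`k = 1`, `m > 0`) for EVERY smooth projective surface** (odd cohomology allowed —
abelian surfaces), for an instance of Nakajima's operators, an EVEN Casimir tensor `C` of the Poincaré pairing
(e.g. the Künneth decomposition of the diagonal) and a graded endomorphism `φ` of even degree `2t`:
`T(φ)𝔮ₘ(v) − 𝔮ₘ(v)T(φ) = mᵗ 𝔮ₘ(φv)`.  (Super-version of the named fact `Oberdieck2021_transfer_bracket`, which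
carries `H^odd(S) = 0`; proved here from the axioms.) [cite: Oberdieck2021, §3.2 Lemma 3.4 p. 7]
[cite: LiQinWang2002, (2.7) and Thm. 2.16 (i) (pp. 4–5)] -/
theorem NakajimaOperators.transferOp_commute_super (𝔑 : NakajimaOperators hS H)
    {C : totalCohomology ℂ (ComplexPoints S) ⊗[ℂ] totalCohomology ℂ (ComplexPoints S)}
    (hCg : C ∈ evenTensorSpan ℂ (coeffFamily S)) (hC : IsCasimir ℂ (poincarePairing hS) C) (t : ℤ)
    {φ : Module.End ℂ (totalCohomology ℂ (ComplexPoints S))} (hφ : IsOfDegree ℂ (ComplexPoints S) φ (2 * t))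
    {m : ℤ} (hm : 0 < m) (v : totalCohomology ℂ (ComplexPoints S)) :
    transferOp ℂ 𝔑.q C t φ * 𝔑.q m v - 𝔑.q m v * transferOp ℂ 𝔑.q C t φ = ((m : ℂ) ^ t) • 𝔑.q m (φ v) :=
  𝔑.isHeisenberg.transferOp_commute_graded (poincarePairing_graded_symm hS) hCg hC t hφ.mem_paritySpan hm v

/-- **Oberdieck's Cor. 3.5 for EVERY smooth projective surface**: `[T(φ), T(ψ)] = T([φ, ψ])` for graded
endomorphisms of even degrees `2t`, `2t'`, an even Casimir tensor and any instance of Nakajima's operators.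
(Super-version of `Oberdieck2021_transfer_lieHom`; proved here from the axioms.)
[cite: Oberdieck2021, §3.2 Cor. 3.5 p. 7] [cite: LiQinWang2002, (2.7) p. 4] -/
theorem NakajimaOperators.transferOp_lie_super (𝔑 : NakajimaOperators hS H)
    {C : totalCohomology ℂ (ComplexPoints S) ⊗[ℂ] totalCohomology ℂ (ComplexPoints S)}
    (hCg : C ∈ evenTensorSpan ℂ (coeffFamily S)) (hC : IsCasimir ℂ (poincarePairing hS) C) (t t' : ℤ)
    {φ ψ : Module.End ℂ (totalCohomology ℂ (ComplexPoints S))} (hφ : IsOfDegree ℂ (ComplexPoints S) φ (2 * t))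
    (hψ : IsOfDegree ℂ (ComplexPoints S) ψ (2 * t')) :
    transferOp ℂ 𝔑.q C t φ * transferOp ℂ 𝔑.q C t' ψ - transferOp ℂ 𝔑.q C t' ψ * transferOp ℂ 𝔑.q C t φ =
      transferOp ℂ 𝔑.q C (t + t') (φ * ψ - ψ * φ) :=
  𝔑.isHeisenberg.transferOp_lie_graded (poincarePairing_graded_symm hS) hCg hC t t' hφ.mem_paritySpan
    hψ.mem_paritySpan

/-- **Lehn's formula `𝔊₀(α) = T(L_α)` for EVERY smooth projective surface** (odd cohomology allowed), for an even
Casimir tensor. [cite: Oberdieck2021, §3.1 (3.1) and §3.2 (3.5), Lemma 3.4 (pp. 6–7)]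
[cite: LiQinWang2002, Thm. 5.13 (iv)] -/
theorem ChernCharacterOperators.cupOperator_zero_eq_transferOp_super (𝔊 : ChernCharacterOperators hS H)
    {C : totalCohomology ℂ (ComplexPoints S) ⊗[ℂ] totalCohomology ℂ (ComplexPoints S)}
    (hCg : C ∈ evenTensorSpan ℂ (coeffFamily S)) (hC : IsCasimir ℂ (poincarePairing hS) C) (α : complexBetti S 2) :
    𝔊.cupOperator 0 (ofDegree ℂ (ComplexPoints S) 2 α) = transferOp ℂ 𝔊.q C 1 (totalLefschetz α) :=
  𝔊.cupOperator_zero_eq_transferOp C α fun m hm γ ↦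
    𝔊.toNakajimaOperators.transferOp_commute_super hCg hC 1 (by simpa using isOfDegree_totalLefschetz (R := ℂ) α)
      hm γ

end Geometric

end Literature.AlgebraicGeometry.HilbertScheme

end
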